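import Mathlib.Data.Nat.Choose.Sum
import Mathlib.Data.Real.Basic
import Mathlib.Order.Monotone.Basic
import Mathlib.Tactic.FieldSimp
import Mathlib.Tactic.Positivity
import Mathlib.Tactic.Linarith
import Mathlib.Tactic.Ring
import Mathlib.Tactic.GCongr
import HarnessLib

/-!
# Jerrum–Snir's weight recurrence for the Hamiltonian circuit polynomial (J. ACM 29 (1982), §4.4)

The arithmetic half of §4.4 of

* [JerrumSnir1982] M. Jerrum, M. Snir, *Some exact complexity results for straight-line
  computations over semirings*, J. ACM 29 (1982) 874–897 (pp. 890–891),

companion of `MonotoneGapPermanentWeights.lean` (which does the same for the permanent, §4.3). For the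
Hamiltonian circuit polynomial `HC_{n×n}` the printed content bound is
`c(r, d) = (d-1)! (r-d-1)! (n-r-1)!` for `r < n` and `c(n, d) = (d-1)! (n-d-1)!` ("the second case
being the degenerate one when `I_c = ∅`", p. 890) — here `hcDelta n r d` — and the weight function is
the solution (3.6) of the recurrence (3.3)–(3.4), `w(r) = Σ_{i=2}^{r} 1/c(i, 1)` — here `hcWeight n r`.

* `JerrumSnir.hcH_succ_le`, `JerrumSnir.hc35` — condition (3.5) for `c`. The paper says "By an
  argument completely analogous to the case of the permanent, we can show that this bound satisfies
  condition (3.5)" (p. 890); written out, (3.5) for `r < n` is (after clearing the common factor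
  `1/((d-1)! (r-d-2)! (n-r-1)!)`) the statement that `x ↦ 1/(x+1) - x! t!/(x+t+1)!` (`hcH t x`,
  `t = n - r - 1`) is non-increasing, which reduces to `(x+2)! (t+1)! ≤ (x+t+2)!`; for `r = n` it
  reduces to `d ≤ n - d - 1`.
* `JerrumSnir.hcWeight_rec` — the recurrence inequality `w(r) ≤ w(d) + w(r-d) + 1/c(r,d)` for
  `1 ≤ d < r ≤ n` (JS Thm. 3.4 with inequalities, via Lemma 3.6: the right-hand side is symmetric in
  `d ↦ r - d`, non-decreasing on `1 ≤ d ≤ r/2` by (3.5), and equal to `w(r)` at `d = 1`); this is the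
  hypothesis `JerrumSnir.WeightBound n (hcDelta n) (hcWeight n)` of the general lower bound of
  `MonotoneGapParseTrees.lean` (this file is deliberately Mathlib-only; the assembly is in
  `MonotoneGapHamiltonianLower.lean`).
* `JerrumSnir.factorial_mul_hcWeight` — `(n-1)! · w(n) = (n-1) [(n-2) 2^{n-3} + 1]` for `n ≥ 3`
  (JS p. 890: `w(n) = Σ_{i=2}^{n-1} 1/((i-2)!(n-i-1)!) + 1/(n-2)! = (2^{n-3}(n-2) + 1)/(n-2)!`, times
  `|mon(HC_{n×n})| = (n-1)!`).
-/

noncomputable section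

namespace Literature.Barriers.ValiantsHypothesis

namespace JerrumSnir

open Finset Nat

/-! ### The content bound and the weight function of the Hamiltonian circuit polynomial -/

/-- JS's content bound for the `n × n` Hamiltonian circuit polynomial:
`c(r, d) = (d-1)! (r-d-1)! (n-r-1)!` for `r < n` and `c(n, d) = (d-1)! (n-d-1)!` (the factor of the
empty third block being `1`), as a real number; junk (the `r = n` formula) for `r > n`.
[cite: JerrumSnir1982, §4.4 (p. 890)] -/
def hcDelta (n r d : ℕ) : ℝ :=
  (((d - 1)! * (r - d - 1)! * (if r < n then (n - r - 1)! else 1) : ℕ) : ℝ)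

/-- `c > 0`. [folklore] -/
theorem hcDelta_pos (n r d : ℕ) : 0 < hcDelta n r d := by
  unfold hcDelta
  have h3 : 0 < (if r < n then (n - r - 1)! else 1) := by
    split_ifs
    · exact Nat.factorial_pos _
    · exact Nat.one_pos
  exact_mod_cast Nat.mul_pos (Nat.mul_pos (Nat.factorial_pos _) (Nat.factorial_pos _)) h3

/-- `c(r, r - d) = c(r, d)` for `d ≤ r`. [cite: JerrumSnir1982, §4.4] -/
theorem hcDelta_symm {n r d : ℕ} (h : d ≤ r) : hcDelta n r (r - d) = hcDelta n r d := by
  unfold hcDelta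
  rw [show r - (r - d) - 1 = d - 1 by omega, Nat.mul_comm ((r - d - 1)!) ((d - 1)!)]

/-- The value `c(r, d) = (d-1)! (r-d-1)! (n-r-1)!` in the range `r < n`, as a product of real
factorials. [cite: JerrumSnir1982, §4.4 (p. 890)] -/
theorem hcDelta_of_lt {n r d : ℕ} (h : r < n) :
    hcDelta n r d = ((d - 1)! : ℝ) * ((r - d - 1)! : ℝ) * ((n - r - 1)! : ℝ) := by
  unfold hcDelta
  rw [if_pos h]
  push_cast
  ring

/-- The value `c(n, d) = (d-1)! (n-d-1)!` in the degenerate case `r = n` (and the junk range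
`r ≥ n`). [cite: JerrumSnir1982, §4.4 (p. 890)] -/
theorem hcDelta_of_not_lt {n r d : ℕ} (h : ¬ r < n) :
    hcDelta n r d = ((d - 1)! : ℝ) * ((r - d - 1)! : ℝ) := by
  unfold hcDelta
  rw [if_neg h]
  push_cast
  ring

/-- JS's weight function for the `n × n` Hamiltonian circuit polynomial,
`w(r) = Σ_{i=2}^{r} 1/c(i, 1)` (written as a sum over `k = i - 2 < r - 1`), the solution (3.6) of
the recurrence (3.3)–(3.4) for `c = hcDelta n`; `w(0) = w(1) = 0`.
[cite: JerrumSnir1982, (3.6) and §4.4 (p. 890)] -/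
def hcWeight (n r : ℕ) : ℝ :=
  ∑ k ∈ Finset.range (r - 1), 1 / hcDelta n (k + 2) 1

/-- `w(0) = 0`. [cite: JerrumSnir1982, (3.3)] -/
@[simp] theorem hcWeight_zero (n : ℕ) : hcWeight n 0 = 0 := by
  simp [hcWeight]

/-- `w(1) = 0`. [cite: JerrumSnir1982, (3.3)] -/
@[simp] theorem hcWeight_one (n : ℕ) : hcWeight n 1 = 0 := by
  simp [hcWeight]

/-- `w(r + 1) = w(r) + 1/c(r + 1, 1)` for `r ≥ 1`. [cite: JerrumSnir1982, (3.6)] -/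
theorem hcWeight_succ (n : ℕ) {r : ℕ} (hr : 1 ≤ r) :
    hcWeight n (r + 1) = hcWeight n r + 1 / hcDelta n (r + 1) 1 := by
  obtain ⟨r, rfl⟩ : ∃ r', r = r' + 1 := ⟨r - 1, by omega⟩
  unfold hcWeight
  rw [Nat.add_sub_cancel, Nat.add_sub_cancel, Finset.sum_range_succ]

/-- `w ≥ 0`. [folklore] -/
theorem hcWeight_nonneg (n r : ℕ) : 0 ≤ hcWeight n r :=
  Finset.sum_nonneg fun _ _ => (one_div_pos.2 (hcDelta_pos _ _ _)).le

/-! ### Condition (3.5) for the Hamiltonian circuit polynomial -/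

/-- The integer inequality behind (3.5) for `HC`: `(x+2)! (t+1)! ≤ (x+t+2)!`, i.e.
`t + 1 ≤ C(x+t+2, t)`. [cite: JerrumSnir1982, §4.4 (p. 890)] -/
theorem factorial_add_two_mul_factorial_succ_le (x t : ℕ) : (x + 2)! * (t + 1)! ≤ (x + t + 2)! := by
  have h := Nat.choose_mul_factorial_mul_factorial (show t ≤ x + t + 2 by omega)
  rw [show x + t + 2 - t = x + 2 by omega] at h
  have hc : t + 1 ≤ (x + t + 2).choose t :=
    calc t + 1 = (t + 1).choose t := (Nat.choose_succ_self_right t).symm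
      _ ≤ (x + t + 2).choose t := Nat.choose_le_choose t (by omega)
  calc (x + 2)! * (t + 1)! = (t + 1) * t ! * (x + 2)! := by rw [Nat.factorial_succ t]; ring
    _ ≤ (x + t + 2).choose t * t ! * (x + 2)! := by gcongr
    _ = (x + t + 2)! := h

/-- The function `H_t(x) = 1/(x+1) - x! t!/(x+t+1)!` whose antitonicity in `x` is condition (3.5)
for `HC` in the range `r < n` (with `t = n - r - 1`, `x ∈ {d - 1, r - d - 2}`).
[cite: JerrumSnir1982, §4.4 (p. 890)] -/
def hcH (t x : ℕ) : ℝ :=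
  1 / ((x : ℝ) + 1) - (x ! : ℝ) * (t ! : ℝ) / ((x + t + 1)! : ℝ)

/-- `H_t(x + 1) ≤ H_t(x)`: the difference is `1/((x+1)(x+2)) - x!(t+1)!/(x+t+2)! ≥ 0` by
`(x+2)!(t+1)! ≤ (x+t+2)!`. [cite: JerrumSnir1982, §4.4 (p. 890)] -/
theorem hcH_succ_le (t x : ℕ) : hcH t (x + 1) ≤ hcH t x := by
  unfold hcH
  set G : ℝ := ((x + t + 1)! : ℝ) with hG
  have hGpos : 0 < G := by rw [hG]; exact_mod_cast Nat.factorial_pos _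
  have hF : (((x + 1 + t + 1)! : ℕ) : ℝ) = ((x : ℝ) + t + 2) * G := by
    rw [show x + 1 + t + 1 = (x + t + 1) + 1 by ring, Nat.factorial_succ]
    push_cast
    ring
  have hx1 : (((x + 1)! : ℕ) : ℝ) = ((x : ℝ) + 1) * (x ! : ℝ) := by
    rw [Nat.factorial_succ]
    push_cast
    ring
  have key : (x ! : ℝ) * (t ! : ℝ) * ((t + 1) * ((x : ℝ) + 1) * (x + 2)) ≤ ((x : ℝ) + t + 2) * G := by
    have h' : (((x + 2)! * (t + 1)! : ℕ) : ℝ) ≤ (((x + t + 2)! : ℕ) : ℝ) := by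
      exact_mod_cast factorial_add_two_mul_factorial_succ_le x t
    have e1 : (((x + 2)! * (t + 1)! : ℕ) : ℝ) =
        (x ! : ℝ) * (t ! : ℝ) * ((t + 1) * ((x : ℝ) + 1) * (x + 2)) := by
      rw [show x + 2 = (x + 1) + 1 by rfl, Nat.factorial_succ (x + 1), Nat.factorial_succ x,
        Nat.factorial_succ t]
      push_cast
      ring
    have e2 : (((x + t + 2)! : ℕ) : ℝ) = ((x : ℝ) + t + 2) * G := by
      rw [show x + t + 2 = (x + t + 1) + 1 by rfl, Nat.factorial_succ]
      push_cast
      ring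
    rwa [e1, e2] at h'
  rw [hF, hx1]
  have hx0 : (0 : ℝ) < (x : ℝ) + 1 := by positivity
  have expr : (1 / ((x : ℝ) + 1) - (x ! : ℝ) * (t ! : ℝ) / G) -
      (1 / (((x + 1 : ℕ) : ℝ) + 1) - ((x : ℝ) + 1) * (x ! : ℝ) * (t ! : ℝ) / (((x : ℝ) + t + 2) * G)) =
      (((x : ℝ) + t + 2) * G - (x ! : ℝ) * (t ! : ℝ) * ((t + 1) * ((x : ℝ) + 1) * (x + 2))) /
        (((x : ℝ) + 1) * ((x : ℝ) + 2) * ((x : ℝ) + t + 2) * G) := by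
    push_cast
    field_simp
    ring
  have hnn : 0 ≤ (1 / ((x : ℝ) + 1) - (x ! : ℝ) * (t ! : ℝ) / G) -
      (1 / (((x + 1 : ℕ) : ℝ) + 1) - ((x : ℝ) + 1) * (x ! : ℝ) * (t ! : ℝ) / (((x : ℝ) + t + 2) * G)) := by
    rw [expr]
    exact div_nonneg (by linarith) (by positivity)
  linarith

/-- `H_t` is non-increasing: `H_t(M) ≤ H_t(D)` for `D ≤ M`. [cite: JerrumSnir1982, §4.4 (p. 890)] -/
theorem hcH_antitone (t : ℕ) : Antitone (hcH t) :=
  antitone_nat_of_succ_le fun x => hcH_succ_le t x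

/-- **Condition (3.5) for `HC`, core form of the case `r < n`**: for `D < M` and all `t`,
`1/(D! (M+1)! t!) + 1/(M! (D+t+1)!) ≤ 1/((D+1)! M! t!) + 1/(D! (M+t+1)!)`; this is (3.5) for
`c = hcDelta n` at `d = D + 1`, `r = D + M + 3`, `n = r + t + 1`, and it is `H_t(M) ≤ H_t(D)`
multiplied by `1/(D! M! t!)`. [cite: JerrumSnir1982, §4.4 (p. 890)] -/
theorem hc35_core {D M : ℕ} (h : D < M) (t : ℕ) :
    1 / ((D ! : ℝ) * ((M + 1)! : ℝ) * (t ! : ℝ)) + 1 / ((M ! : ℝ) * ((D + t + 1)! : ℝ)) ≤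
      1 / (((D + 1)! : ℝ) * (M ! : ℝ) * (t ! : ℝ)) + 1 / ((D ! : ℝ) * ((M + t + 1)! : ℝ)) := by
  have hH := hcH_antitone t h.le
  unfold hcH at hH
  have hD : (0 : ℝ) < D ! := by exact_mod_cast Nat.factorial_pos _
  have hM : (0 : ℝ) < M ! := by exact_mod_cast Nat.factorial_pos _
  have ht : (0 : ℝ) < t ! := by exact_mod_cast Nat.factorial_pos _
  have hDt : (0 : ℝ) < (D + t + 1)! := by exact_mod_cast Nat.factorial_pos _
  have hMt : (0 : ℝ) < (M + t + 1)! := by exact_mod_cast Nat.factorial_pos _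
  have hM1 : ((M + 1)! : ℝ) = ((M : ℝ) + 1) * (M ! : ℝ) := by
    rw [Nat.factorial_succ]; push_cast; ring
  have hD1 : ((D + 1)! : ℝ) = ((D : ℝ) + 1) * (D ! : ℝ) := by
    rw [Nat.factorial_succ]; push_cast; ring
  rw [hM1, hD1]
  have e1 : 1 / ((D ! : ℝ) * (((M : ℝ) + 1) * (M ! : ℝ)) * (t ! : ℝ)) +
      1 / ((M ! : ℝ) * ((D + t + 1)! : ℝ)) =
      (1 / ((D ! : ℝ) * (M ! : ℝ) * (t ! : ℝ))) *
        (1 / ((M : ℝ) + 1) - (M ! : ℝ) * (t ! : ℝ) / ((M + t + 1)! : ℝ)) +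
        (1 / ((D ! : ℝ) * ((M + t + 1)! : ℝ)) + 1 / ((M ! : ℝ) * ((D + t + 1)! : ℝ))) := by
    field_simp
    ring
  have e2 : 1 / (((D : ℝ) + 1) * (D ! : ℝ) * (M ! : ℝ) * (t ! : ℝ)) +
      1 / ((D ! : ℝ) * ((M + t + 1)! : ℝ)) =
      (1 / ((D ! : ℝ) * (M ! : ℝ) * (t ! : ℝ))) *
        (1 / ((D : ℝ) + 1) - (D ! : ℝ) * (t ! : ℝ) / ((D + t + 1)! : ℝ)) +
        (1 / ((D ! : ℝ) * ((M + t + 1)! : ℝ)) + 1 / ((M ! : ℝ) * ((D + t + 1)! : ℝ))) := by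
    field_simp
    ring
  rw [e1, e2]
  have hpos : (0 : ℝ) ≤ 1 / ((D ! : ℝ) * (M ! : ℝ) * (t ! : ℝ)) := by positivity
  nlinarith [mul_le_mul_of_nonneg_left hH hpos]

/-- **Condition (3.5) for `HC`** (JS p. 890, "completely analogous to the case of the permanent"):
for `1 ≤ d`, `2d + 2 ≤ r ≤ n`, `1/c(r, d) + 1/c(r - d, 1) ≤ 1/c(r, d + 1) + 1/c(d + 1, 1)`.
[cite: JerrumSnir1982, (3.5) and §4.4 (p. 890)] -/
theorem hc35 {n r d : ℕ} (hd : 1 ≤ d) (hr : 2 * d + 2 ≤ r) (hrn : r ≤ n) :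
    1 / hcDelta n r d + 1 / hcDelta n (r - d) 1 ≤
      1 / hcDelta n r (d + 1) + 1 / hcDelta n (d + 1) 1 := by
  rcases Nat.lt_or_ge r n with hlt | hge
  · -- the case `r < n`
    obtain ⟨D, rfl⟩ : ∃ D, d = D + 1 := ⟨d - 1, by omega⟩
    obtain ⟨M, rfl⟩ : ∃ M, r = D + M + 3 := ⟨r - D - 3, by omega⟩
    obtain ⟨t, rfl⟩ : ∃ t, n = D + M + 3 + t + 1 := ⟨n - (D + M + 3) - 1, by omega⟩
    have hDM : D < M := by omega
    have h := hc35_core hDM t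
    have e1 : hcDelta (D + M + 3 + t + 1) (D + M + 3) (D + 1) = (D ! : ℝ) * ((M + 1)! : ℝ) * (t ! : ℝ) := by
      rw [hcDelta_of_lt hlt, show D + 1 - 1 = D by omega, show D + M + 3 - (D + 1) - 1 = M + 1 by omega,
        show D + M + 3 + t + 1 - (D + M + 3) - 1 = t by omega]
    have e2 : hcDelta (D + M + 3 + t + 1) (D + M + 3 - (D + 1)) 1 = (M ! : ℝ) * ((D + t + 1)! : ℝ) := by
      rw [hcDelta_of_lt (by omega), show 1 - 1 = 0 by rfl, show D + M + 3 - (D + 1) - 1 - 1 = M by omega,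
        show D + M + 3 + t + 1 - (D + M + 3 - (D + 1)) - 1 = D + t + 1 by omega, Nat.factorial_zero,
        Nat.cast_one, one_mul]
    have e3 : hcDelta (D + M + 3 + t + 1) (D + M + 3) (D + 1 + 1) = ((D + 1)! : ℝ) * (M ! : ℝ) * (t ! : ℝ) := by
      rw [hcDelta_of_lt hlt, show D + 1 + 1 - 1 = D + 1 by omega, show D + M + 3 - (D + 1 + 1) - 1 = M by omega,
        show D + M + 3 + t + 1 - (D + M + 3) - 1 = t by omega]
    have e4 : hcDelta (D + M + 3 + t + 1) (D + 1 + 1) 1 = (D ! : ℝ) * ((M + t + 1)! : ℝ) := by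
      rw [hcDelta_of_lt (by omega), show 1 - 1 = 0 by rfl, show D + 1 + 1 - 1 - 1 = D by omega,
        show D + M + 3 + t + 1 - (D + 1 + 1) - 1 = M + t + 1 by omega, Nat.factorial_zero, Nat.cast_one,
        one_mul]
    rw [e1, e2, e3, e4]
    exact h
  · -- the degenerate case `r = n`
    have hrn' : r = n := le_antisymm hrn hge
    subst hrn'
    obtain ⟨D, rfl⟩ : ∃ D, d = D + 1 := ⟨d - 1, by omega⟩
    obtain ⟨K, rfl⟩ : ∃ K, r = D + K + 3 := ⟨r - D - 3, by omega⟩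
    have hDK : D + 1 ≤ K := by omega
    have e1 : hcDelta (D + K + 3) (D + K + 3) (D + 1) = (D ! : ℝ) * ((K + 1)! : ℝ) := by
      rw [hcDelta_of_not_lt (lt_irrefl _), show D + 1 - 1 = D by omega,
        show D + K + 3 - (D + 1) - 1 = K + 1 by omega]
    have e2 : hcDelta (D + K + 3) (D + K + 3 - (D + 1)) 1 = (K ! : ℝ) * (D ! : ℝ) := by
      rw [hcDelta_of_lt (by omega), show 1 - 1 = 0 by rfl, show D + K + 3 - (D + 1) - 1 - 1 = K by omega,
        show D + K + 3 - (D + K + 3 - (D + 1)) - 1 = D by omega, Nat.factorial_zero, Nat.cast_one, one_mul]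
    have e3 : hcDelta (D + K + 3) (D + K + 3) (D + 1 + 1) = ((D + 1)! : ℝ) * (K ! : ℝ) := by
      rw [hcDelta_of_not_lt (lt_irrefl _), show D + 1 + 1 - 1 = D + 1 by omega,
        show D + K + 3 - (D + 1 + 1) - 1 = K by omega]
    have e4 : hcDelta (D + K + 3) (D + 1 + 1) 1 = (D ! : ℝ) * (K ! : ℝ) := by
      rw [hcDelta_of_lt (by omega), show 1 - 1 = 0 by rfl, show D + 1 + 1 - 1 - 1 = D by omega,
        show D + K + 3 - (D + 1 + 1) - 1 = K by omega, Nat.factorial_zero, Nat.cast_one, one_mul]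
    rw [e1, e2, e3, e4]
    have hD : (0 : ℝ) < D ! := by exact_mod_cast Nat.factorial_pos _
    have hK : (0 : ℝ) < K ! := by exact_mod_cast Nat.factorial_pos _
    have hK1 : ((K + 1)! : ℝ) = ((K : ℝ) + 1) * (K ! : ℝ) := by
      rw [Nat.factorial_succ]; push_cast; ring
    have hD1 : ((D + 1)! : ℝ) = ((D : ℝ) + 1) * (D ! : ℝ) := by
      rw [Nat.factorial_succ]; push_cast; ring
    rw [hK1, hD1, mul_comm (K ! : ℝ) (D ! : ℝ)]
    have hle : 1 / ((D ! : ℝ) * (((K : ℝ) + 1) * (K ! : ℝ))) ≤ 1 / (((D : ℝ) + 1) * (D ! : ℝ) * (K ! : ℝ)) := by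
      apply one_div_le_one_div_of_le (by positivity)
      have hDK' : (D : ℝ) + 1 ≤ (K : ℝ) + 1 := by exact_mod_cast Nat.succ_le_succ (by omega : D ≤ K)
      nlinarith [mul_pos hD hK]
    linarith

/-! ### The recurrence inequality for `w` (JS Thm. 3.4 / Lemma 3.6) -/

/-- **The recurrence (3.4) with `≤` for the `HC` content bound and weight**: for `1 ≤ d < r ≤ n`,
`w(r) ≤ w(d) + w(r - d) + 1/c(r, d)`. Proof as in JS Lemma 3.6: the right-hand side is symmetric
under `d ↦ r - d`, non-decreasing in `d` on `1 ≤ d ≤ r/2` by (3.5), and equal to `w(r)` at `d = 1`.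
[cite: JerrumSnir1982, Thm. 3.4, Lemma 3.6 and §4.4] -/
theorem hcWeight_rec {n r d : ℕ} (hd : 1 ≤ d) (hdr : d < r) (hrn : r ≤ n) :
    hcWeight n r ≤ hcWeight n d + hcWeight n (r - d) + 1 / hcDelta n r d := by
  wlog h2 : 2 * d ≤ r generalizing d
  · have h := this (d := r - d) (by omega) (by omega) (by omega)
    rw [Nat.sub_sub_self hdr.le, hcDelta_symm hdr.le] at h
    linarith
  -- the value at `d = 1`
  have hg1 : hcWeight n r = hcWeight n 1 + hcWeight n (r - 1) + 1 / hcDelta n r 1 := by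
    rw [hcWeight_one, zero_add]
    obtain ⟨r', rfl⟩ : ∃ r', r = r' + 1 := ⟨r - 1, by omega⟩
    rw [Nat.add_sub_cancel, hcWeight_succ n (by omega : 1 ≤ r')]
  -- monotonicity in `d` on `1 ≤ d ≤ r/2`, from (3.5)
  have hmono : ∀ e : ℕ, 1 ≤ e → 2 * (e + 1) ≤ r →
      hcWeight n e + hcWeight n (r - e) + 1 / hcDelta n r e ≤
        hcWeight n (e + 1) + hcWeight n (r - (e + 1)) + 1 / hcDelta n r (e + 1) := by
    intro e he her
    have h35 := hc35 (n := n) he (by omega) hrn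
    have hw1 : hcWeight n (e + 1) = hcWeight n e + 1 / hcDelta n (e + 1) 1 := hcWeight_succ n he
    have hw2 : hcWeight n (r - e) = hcWeight n (r - (e + 1)) + 1 / hcDelta n (r - e) 1 := by
      have hre : r - e = (r - (e + 1)) + 1 := by omega
      rw [hre]
      exact hcWeight_succ n (by omega : 1 ≤ r - (e + 1))
    linarith
  have hind : ∀ e : ℕ, 1 ≤ e → 2 * e ≤ r →
      hcWeight n 1 + hcWeight n (r - 1) + 1 / hcDelta n r 1 ≤
        hcWeight n e + hcWeight n (r - e) + 1 / hcDelta n r e := by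
    intro e he
    induction e, he using Nat.le_induction with
    | base => intro; exact le_rfl
    | succ e he ih => intro h; exact (ih (by omega)).trans (hmono e he h)
  rw [hg1]
  exact hind d hd h2

/-! ### The value `(n-1)! · w(n) = (n-1) [(n-2) 2^{n-3} + 1]` -/

/-- **`(n-1)! · w(n) = (n-1) [(n-2) 2^{n-3} + 1]`** for `n ≥ 3` (JS p. 890:
`w(n) = Σ_{i=2}^{n-1} 1/((i-2)!(n-i-1)!) + 1/(n-2)! = (2^{n-3}(n-2) + 1)/(n-2)!`, and
`(n-1)!/(n-2)! · [2^{n-3}(n-2) + 1] = (n-1)[(n-2)2^{n-3} + 1]`). [cite: JerrumSnir1982, §4.4 (p. 890)] -/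
theorem factorial_mul_hcWeight {n : ℕ} (hn : 3 ≤ n) :
    ((n - 1)! : ℝ) * hcWeight n n = ((n : ℝ) - 1) * (((n : ℝ) - 2) * 2 ^ (n - 3) + 1) := by
  obtain ⟨N, rfl⟩ : ∃ N, n = N + 3 := ⟨n - 3, by omega⟩
  rw [show N + 3 - 1 = N + 2 by omega, show N + 3 - 3 = N by omega]
  unfold hcWeight
  rw [show N + 3 - 1 = N + 1 + 1 by omega, Finset.sum_range_succ]
  -- the last term `i = n`: `c(n, 1) = (n-2)!`
  have hlast : hcDelta (N + 3) (N + 1 + 2) 1 = ((N + 1)! : ℝ) := by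
    rw [hcDelta_of_not_lt (by omega), show 1 - 1 = 0 by rfl, show N + 1 + 2 - 1 - 1 = N + 1 by omega,
      Nat.factorial_zero, Nat.cast_one, one_mul]
  -- the terms `2 ≤ i ≤ n - 1`: `(n-1)!/((i-2)!(n-i-1)!) = (n-1)(n-2) C(n-3, i-2)`
  have hterm : ∀ k ∈ Finset.range (N + 1),
      ((N + 2)! : ℝ) * (1 / hcDelta (N + 3) (k + 2) 1) = ((N : ℝ) + 2) * ((N : ℝ) + 1) * (N.choose k : ℝ) := by
    intro k hk
    rw [Finset.mem_range] at hk
    rw [hcDelta_of_lt (by omega : k + 2 < N + 3), show 1 - 1 = 0 by rfl, show k + 2 - 1 - 1 = k by omega,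
      show N + 3 - (k + 2) - 1 = N - k by omega, Nat.factorial_zero, Nat.cast_one, one_mul]
    have h := Nat.choose_mul_factorial_mul_factorial (show k ≤ N by omega)
    have hpos : (0 : ℝ) < (k ! : ℝ) * ((N - k)! : ℝ) := by positivity
    have hN2 : ((N + 2)! : ℝ) = ((N : ℝ) + 2) * ((N : ℝ) + 1) * (N ! : ℝ) := by
      rw [Nat.factorial_succ, Nat.factorial_succ]
      push_cast
      ring
    have hNf : (N ! : ℝ) = (N.choose k : ℝ) * (k ! : ℝ) * ((N - k)! : ℝ) := by exact_mod_cast h.symm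
    rw [hN2, mul_one_div, div_eq_iff hpos.ne', hNf]
    ring
  rw [mul_add, Finset.mul_sum, Finset.sum_congr rfl hterm, ← Finset.mul_sum, hlast]
  have hsum : ∑ k ∈ Finset.range (N + 1), (N.choose k : ℝ) = 2 ^ N := by
    exact_mod_cast Nat.sum_range_choose N
  have hN2' : ((N + 2)! : ℝ) * (1 / ((N + 1)! : ℝ)) = (N : ℝ) + 2 := by
    have hpos : (0 : ℝ) < ((N + 1)! : ℝ) := by exact_mod_cast Nat.factorial_pos _
    rw [mul_one_div, div_eq_iff hpos.ne', Nat.factorial_succ (N + 1)]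
    push_cast
    ring
  rw [hsum, hN2']
  push_cast
  ring

/-- The same value as a natural number cast: `(n-1)! · w(n) = ↑((n-1)((n-2)2^{n-3} + 1))`.
[cite: JerrumSnir1982, §4.4 (p. 890)] -/
theorem factorial_mul_hcWeight_eq_natCast {n : ℕ} (hn : 3 ≤ n) :
    ((n - 1)! : ℝ) * hcWeight n n = (((n - 1) * ((n - 2) * 2 ^ (n - 3) + 1) : ℕ) : ℝ) := by
  rw [factorial_mul_hcWeight hn, Nat.cast_mul, Nat.cast_add, Nat.cast_mul, Nat.cast_sub (by omega),
    Nat.cast_sub (by omega)]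
  push_cast
  ring

end JerrumSnir

end Literature.Barriers.ValiantsHypothesis
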